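import Mathlib
import Summits.Ventures.PercRepro2.LocRows
import Summits.Ventures.PercRepro2.SwRow
import Summits.Ventures.PercRepro2.SwOut
import Summits.Ventures.PercRepro2.SwAllRow
import Summits.Ventures.PercRepro2.SwOutAll
import Summits.Ventures.PercRepro2.SwOutArmFlip

/-!
# The arms of a core-free configuration (blind cell PercRepro2, night-4 g10, 2026-08-25;
proofs/NIGHT4-G10.md §7, the ARM PRINCIPLE, part 2)

The ARMS of a core-free configuration are the components of the graph induced on `hull ∖ {h}`
(`arm ζ h x` = the cluster of `x` in the all-open colouring of the edges inside `hull ∖ {h}`).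
Each arm is arm-closed (`armClosed_arm`), every vertex of `hull ∖ {h}` lies in the arm of the end of
a star edge at `h` (`exists_starEnd_arm`), and the arms of two vertices either coincide or are
disjoint (`arm_eq_of_mem`).  The finite set of arms `arms ζ h` is the image of the star edges at `h`
into the hull; `armsFalse ω` is the union of the arms assigned `false` by a cube point
`ω : Config (arms ζ h)`.
-/

namespace Summit.Ventures.PercRepro2

namespace LocRows

open Hull

variable {V : Type*} {E : Type*} [Fintype E] [DecidableEq E]

open scoped Classical

variable (ends : E → Sym2 V)

/-- The all-open colouring of the edges inside `hull ∖ {h}`. -/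
noncomputable def armConfig (ζ : Config E) (h : V) : Config E :=
  fun e => decide (e ∈ within ends (hull ends ζ h \ {h}))

/-- The arm of `x`: its component in the graph induced on `hull ∖ {h}`. -/
noncomputable def arm (ζ : Config E) (h : V) (x : V) : Set V :=
  cluster ends (armConfig ends ζ h) x

/-- The star edges at `h` into the hull (no loops). -/
noncomputable def starEdges (ζ : Config E) (h : V) : Finset E :=
  Finset.univ.filter fun e => ∃ y, ends e = s(h, y) ∧ y ≠ h ∧ y ∈ hull ends ζ h

/-- The arm reached by a star edge: the arm of its end other than `h`. -/
noncomputable def armOfEdge (ζ : Config E) (h : V) (e : E) : Set V :=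
  {x | ∃ y ∈ ends e, y ≠ h ∧ x ∈ arm ends ζ h y}

/-- The finite set of arms. -/
noncomputable def arms (ζ : Config E) (h : V) : Finset (Set V) :=
  (starEdges ends ζ h).image (armOfEdge ends ζ h)

/-- The union of the arms assigned `false` by a cube point. -/
def armsFalse (ζ : Config E) (h : V) (ω : Config (arms ends ζ h)) : Set V :=
  {x | ∃ P : arms ends ζ h, ω P = false ∧ x ∈ P.1}

variable {ends}

section Arms

variable {ζ : Config E} {h : V}

omit [Fintype E] [DecidableEq E] in
/-- The arm colouring is open exactly on the edges inside `hull ∖ {h}`. -/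
lemma armConfig_eq_true_iff {e : E} :
    armConfig ends ζ h e = true ↔ e ∈ within ends (hull ends ζ h \ {h}) := by
  simp [armConfig]

omit [Fintype E] [DecidableEq E] in
/-- The arm of a vertex of `hull ∖ {h}` lies in `hull ∖ {h}`. -/
lemma arm_subset {x : V} (hx : x ∈ hull ends ζ h) (hxh : x ≠ h) :
    arm ends ζ h x ⊆ hull ends ζ h \ {h} := by
  intro v hv
  refine mem_of_conn_of_closed (ends := ends) (ω := armConfig ends ζ h) ?_ ⟨hx, hxh⟩ hv
  intro a _ b hab
  obtain ⟨_, e, he, hends⟩ := openGraph_adj.1 hab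
  obtain ⟨x', hx', y', hy', h'⟩ := armConfig_eq_true_iff.1 he
  rw [hends, Sym2.eq_iff] at h'
  rcases h' with ⟨rfl, rfl⟩ | ⟨rfl, rfl⟩
  · exact hy'
  · exact hx'

omit [Fintype E] [DecidableEq E] in
/-- Arms are closed under adjacency inside `hull ∖ {h}`. -/
lemma mem_arm_of_edge {x a b : V} {e : E} (ha : a ∈ arm ends ζ h x) (haH : a ∈ hull ends ζ h)
    (hah : a ≠ h) (hbH : b ∈ hull ends ζ h) (hbh : b ≠ h) (hends : ends e = s(a, b)) :
    b ∈ arm ends ζ h x := by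
  have he : armConfig ends ζ h e = true :=
    armConfig_eq_true_iff.2 ⟨a, ⟨haH, hah⟩, b, ⟨hbH, hbh⟩, hends⟩
  exact mem_cluster_of_edge ha he hends

omit [Fintype E] [DecidableEq E] in
/-- An arm is arm-closed. -/
lemma armClosed_arm {x : V} (hx : x ∈ hull ends ζ h) (hxh : x ≠ h) :
    ArmClosed ends ζ h (arm ends ζ h x) := by
  refine ⟨fun v hv => arm_subset hx hxh hv, fun e a b hab ha hbH hbh => ?_⟩
  have haS := arm_subset hx hxh ha
  exact mem_arm_of_edge ha haS.1 haS.2 hbH hbh hab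

omit [Fintype E] [DecidableEq E] in
/-- `x` lies in its arm. -/
lemma mem_arm_self (x : V) : x ∈ arm ends ζ h x := mem_cluster_self _ _ _

omit [Fintype E] [DecidableEq E] in
/-- The arm of a vertex of the arm of `x` is the arm of `x`. -/
lemma arm_eq_of_mem {x y : V} (hy : y ∈ arm ends ζ h x) : arm ends ζ h y = arm ends ζ h x := by
  ext v
  constructor
  · exact fun hv => conn_trans hy hv
  · exact fun hv => conn_trans (conn_symm hy) hv

omit [Fintype E] [DecidableEq E] in
/-- A union of arm-closed sets is arm-closed (for the union over any family of arms). -/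
lemma armClosed_iUnion {ι : Sort*} (P : ι → Set V) (hP : ∀ i, ArmClosed ends ζ h (P i)) :
    ArmClosed ends ζ h (⋃ i, P i) := by
  refine ⟨fun x hx => ?_, fun e x y hxy hx hyH hyh => ?_⟩
  · obtain ⟨i, hi⟩ := Set.mem_iUnion.1 hx
    exact (hP i).subset x hi
  · obtain ⟨i, hi⟩ := Set.mem_iUnion.1 hx
    exact Set.mem_iUnion.2 ⟨i, (hP i).closed e x y hxy hi hyH hyh⟩

omit [DecidableEq E] in
/-- The end `≠ h` of a star edge lies in the hull. -/
lemma mem_hull_of_mem_starEdge {e : E} (he : e ∈ starEdges ends ζ h) {y : V} (hy : y ∈ ends e)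
    (hyh : y ≠ h) : y ∈ hull ends ζ h := by
  simp only [starEdges, Finset.mem_filter, Finset.mem_univ, true_and] at he
  obtain ⟨y', hy', hy'h, hy'H⟩ := he
  rw [hy', Sym2.mem_iff] at hy
  rcases hy with rfl | rfl
  · exact absurd rfl hyh
  · exact hy'H

omit [DecidableEq E] in
/-- A vertex of the arm of a star edge lies in `hull ∖ {h}`. -/
lemma mem_hull_sdiff_of_mem_armOfEdge {e : E} (he : e ∈ starEdges ends ζ h) {a : V}
    (ha : a ∈ armOfEdge ends ζ h e) : a ∈ hull ends ζ h ∧ a ≠ h := by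
  obtain ⟨y, hy, hyh, hay⟩ := ha
  exact arm_subset (mem_hull_of_mem_starEdge he hy hyh) hyh hay

omit [DecidableEq E] in
/-- Along a cluster of `h` (red or blue), every vertex other than `h` lies in the arm of a star end. -/
lemma exists_starEdge_arm_aux (ω : Config E) (hω : hull ends ω h = hull ends ζ h) {v : V}
    (hv : v ∈ cluster ends ω h) :
    v = h ∨ ∃ e ∈ starEdges ends ζ h, v ∈ armOfEdge ends ζ h e := by
  have hsub : cluster ends ω h ⊆ hull ends ζ h := by
    intro u hu; rw [← hω]; exact Or.inl hu
  refine (mem_of_conn_of_closed (ends := ends) (ω := ω)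
    (S := {v | v ∈ cluster ends ω h ∧
      (v = h ∨ ∃ e ∈ starEdges ends ζ h, v ∈ armOfEdge ends ζ h e)}) ?_
    ⟨mem_cluster_self _ _ _, Or.inl rfl⟩ hv).2
  intro a ha b hab
  obtain ⟨hne, e, he, hends⟩ := openGraph_adj.1 hab
  have hbC : b ∈ cluster ends ω h := mem_cluster_of_edge ha.1 he hends
  refine ⟨hbC, ?_⟩
  by_cases hbh : b = h
  · exact Or.inl hbh
  right
  rcases ha.2 with rfl | ⟨e₀, he₀, hae₀⟩
  · refine ⟨e, ?_, b, ?_, hbh, mem_arm_self b⟩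
    · simp only [starEdges, Finset.mem_filter, Finset.mem_univ, true_and]
      exact ⟨b, hends, hbh, hsub hbC⟩
    · rw [hends]; exact Sym2.mem_mk_right a b
  · obtain ⟨haH, hah⟩ := mem_hull_sdiff_of_mem_armOfEdge he₀ hae₀
    obtain ⟨y, hy, hyh, hay⟩ := hae₀
    exact ⟨e₀, he₀, y, hy, hyh, mem_arm_of_edge hay haH hah (hsub hbC) hbh hends⟩

omit [DecidableEq E] in
/-- **Every vertex of `hull ∖ {h}` lies in the arm of a star edge.** -/
theorem exists_starEdge_arm {x : V} (hx : x ∈ hull ends ζ h) (hxh : x ≠ h) :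
    ∃ e ∈ starEdges ends ζ h, x ∈ armOfEdge ends ζ h e := by
  rcases hx with hx | hx
  · rcases exists_starEdge_arm_aux ζ rfl hx with h' | h'
    · exact absurd h' hxh
    · exact h'
  · rcases exists_starEdge_arm_aux (blue ζ) (hull_blue ζ h) hx with h' | h'
    · exact absurd h' hxh
    · exact h'

omit [DecidableEq E] in
/-- The arm of a star edge is an arm (of its end). -/
lemma armOfEdge_eq_arm {e : E} (he : e ∈ starEdges ends ζ h) :
    ∃ y, ends e = s(h, y) ∧ y ≠ h ∧ y ∈ hull ends ζ h ∧ armOfEdge ends ζ h e = arm ends ζ h y := by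
  simp only [starEdges, Finset.mem_filter, Finset.mem_univ, true_and] at he
  obtain ⟨y, hy, hyh, hyH⟩ := he
  refine ⟨y, hy, hyh, hyH, ?_⟩
  ext x
  constructor
  · rintro ⟨y', hy', hy'h, hxy'⟩
    rw [hy, Sym2.mem_iff] at hy'
    rcases hy' with rfl | rfl
    · exact absurd rfl hy'h
    · exact hxy'
  · intro hx
    exact ⟨y, by rw [hy]; exact Sym2.mem_mk_right h y, hyh, hx⟩

omit [DecidableEq E] in
/-- Every arm is arm-closed. -/
lemma armClosed_of_mem_arms {P : Set V} (hP : P ∈ arms ends ζ h) : ArmClosed ends ζ h P := by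
  simp only [arms, Finset.mem_image] at hP
  obtain ⟨e, he, rfl⟩ := hP
  obtain ⟨y, _, hyh, hyH, hPy⟩ := armOfEdge_eq_arm he
  rw [hPy]
  exact armClosed_arm hyH hyh

omit [DecidableEq E] in
/-- Two arms containing a common vertex coincide. -/
lemma arms_eq_of_mem {P Q : Set V} (hP : P ∈ arms ends ζ h) (hQ : Q ∈ arms ends ζ h) {x : V}
    (hxP : x ∈ P) (hxQ : x ∈ Q) : P = Q := by
  simp only [arms, Finset.mem_image] at hP hQ
  obtain ⟨e, he, rfl⟩ := hP
  obtain ⟨e', he', rfl⟩ := hQ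
  obtain ⟨y, _, _, _, hPy⟩ := armOfEdge_eq_arm he
  obtain ⟨y', _, _, _, hPy'⟩ := armOfEdge_eq_arm he'
  rw [hPy] at hxP ⊢
  rw [hPy'] at hxQ ⊢
  rw [← arm_eq_of_mem hxP, ← arm_eq_of_mem hxQ]

omit [DecidableEq E] in
/-- The union of the arms assigned `false` is arm-closed. -/
lemma armClosed_armsFalse (ω : Config (arms ends ζ h)) :
    ArmClosed ends ζ h (armsFalse ends ζ h ω) := by
  have : armsFalse ends ζ h ω = ⋃ P : {P : arms ends ζ h // ω P = false}, P.1.1 := by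
    ext x
    simp only [armsFalse, Set.mem_setOf_eq, Set.mem_iUnion]
    constructor
    · rintro ⟨P, hP, hx⟩; exact ⟨⟨P, hP⟩, hx⟩
    · rintro ⟨⟨P, hP⟩, hx⟩; exact ⟨P, hP, hx⟩
  rw [this]
  exact armClosed_iUnion _ fun P => armClosed_of_mem_arms P.1.2

omit [DecidableEq E] in
/-- The arms cover `hull ∖ {h}`: a vertex there lies in some arm. -/
lemma exists_mem_arms {x : V} (hx : x ∈ hull ends ζ h) (hxh : x ≠ h) :
    ∃ P ∈ arms ends ζ h, x ∈ P := by
  obtain ⟨e, he, hxe⟩ := exists_starEdge_arm hx hxh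
  exact ⟨armOfEdge ends ζ h e, Finset.mem_image.2 ⟨e, he, rfl⟩, hxe⟩

omit [DecidableEq E] in
/-- A vertex of an arm lies in `hull ∖ {h}`. -/
lemma mem_hull_sdiff_of_mem_arms {P : Set V} (hP : P ∈ arms ends ζ h) {x : V} (hx : x ∈ P) :
    x ∈ hull ends ζ h ∧ x ≠ h := (armClosed_of_mem_arms hP).subset x hx

end Arms

end LocRows

end Summit.Ventures.PercRepro2
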